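import Literature.Claims.NS.LiuYong2026
import Mathlib.NumberTheory.Padics.PadicVal.Basic
import Mathlib.Data.Int.CardIntervalMod
import HarnessLib

/-!
# C138 `LiuYong2026` — arithmetic of the exact-K41 slot flow (part 1/2 of `not_Step4_H1`)

Engine-independent ingredients of the witness for
`Summit.NavierStokesRegularity.NavierStokesRegularity.Theorems.LiuYong2026.not_Step4_H1 :
¬ Literature.Claims.NS.LiuYong2026.Step4_H1` (part 2: `SoloRefuteLiuYong2026Step4K41.lean`):

1. the 2-adic slot schedule `sched n = v₂(n+1)` — slot `[n, n+1)` plays the mode of index `v₂(n+1)`, so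
   index `j` recurs with density `2^{−(j+1)}`: `|#{n < N : v₂(n+1) = j} − N/2^{j+1}| ≤ 1` (`abs_cnt_sub_le`);
2. an enumeration of `ℤ³ ∖ 0` up to sign: `modeAt : ℕ → ℤ³ ∖ 0` (onto), `rep j` = least index of the
   `±`-class of `modeAt j`; «active» indices `rep j = j` meet every class exactly once and are unbounded;
   a divergence-free polarisation `pol k ⊥ k`, `pol k ≠ 0`;
3. the exact Kolmogorov profile `PhiK k = |k|^{−5/3}` (`k ≠ 0`): `IsK41 PhiK` (constant `C = 1`),
   `InfraredBounded PhiK`; and the Cesàro limit lemma `|G(T) − A T| ≤ B ⇒ T⁻¹ G(T) → A`.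

No analysis of the flow lives here. ns-claims refuter-6 g3 (D-0090 claims sweep), records-grade companion
of row #119. WHAT THIS IS NOT: not a claim about NS regularity or blow-up; not a claim about any author
beyond the typed locator.
-/

set_option linter.dupNamespace false
set_option autoImplicit false

noncomputable section

open Set Filter Topology Finset

open Literature.Claims.NS.LiuYong2026 Literature.Analysis Literature.Analysis.FunctionSpaces

namespace Summit.NavierStokesRegularity.NavierStokesRegularity.Theorems.LiuYong2026.K41Slot

/-! ## 1. The 2-adic schedule -/

/-- Slot `n` plays the mode of index `v₂(n + 1)`. -/
def sched (n : ℕ) : ℕ := padicValNat 2 (n + 1)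

/-- `v₂(n+1) = j ↔ (n + 1) mod 2^{j+1} = 2^j`. -/
theorem sched_eq_iff (n j : ℕ) : sched n = j ↔ (n + 1) % 2 ^ (j + 1) = 2 ^ j := by
  have hn : n + 1 ≠ 0 := Nat.succ_ne_zero n
  constructor
  · intro h
    have h1 : 2 ^ j ∣ n + 1 := by rw [← h]; exact pow_padicValNat_dvd
    have h2 : ¬ 2 ^ (j + 1) ∣ n + 1 := by rw [← h]; exact pow_succ_padicValNat_not_dvd hn
    obtain ⟨m, hm⟩ := h1
    have hodd : m % 2 = 1 := by
      rcases Nat.mod_two_eq_zero_or_one m with h0 | h1'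
      · exact absurd ⟨m / 2, by rw [hm, pow_succ, mul_assoc, Nat.mul_div_cancel' (Nat.dvd_of_mod_eq_zero h0)]⟩ h2
      · exact h1'
    have hm' : m = 2 * (m / 2) + 1 := by
      have := Nat.div_add_mod m 2
      omega
    rw [hm, pow_succ, hm', show 2 ^ j * (2 * (m / 2) + 1) = 2 ^ j * 2 * (m / 2) + 2 ^ j by ring,
      Nat.mul_add_mod]
    exact Nat.mod_eq_of_lt (by omega)
  · intro h
    apply le_antisymm
    · by_contra hlt
      push Not at hlt
      have hdvd : 2 ^ (j + 1) ∣ n + 1 := (padicValNat_dvd_iff_le hn).2 hlt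
      rw [Nat.dvd_iff_mod_eq_zero] at hdvd
      rw [hdvd] at h
      exact absurd h (by positivity)
    · refine (padicValNat_dvd_iff_le hn).1 ?_
      have hdm := Nat.div_add_mod (n + 1) (2 ^ (j + 1))
      rw [h, pow_succ] at hdm
      exact ⟨2 * ((n + 1) / (2 ^ j * 2)) + 1, by linarith [hdm]⟩

/-- `v₂(n+1) = j ↔ n ≡ 2^j − 1 (mod 2^{j+1})`. -/
theorem sched_eq_iff_modEq (n j : ℕ) : sched n = j ↔ n ≡ 2 ^ j - 1 [MOD 2 ^ (j + 1)] := by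
  have hP : 1 ≤ 2 ^ j := Nat.one_le_two_pow
  have hlt : 2 ^ j < 2 ^ (j + 1) := Nat.pow_lt_pow_right (by norm_num) (Nat.lt_succ_self j)
  rw [sched_eq_iff]
  constructor
  · intro h
    have h1 : n + 1 ≡ 2 ^ j [MOD 2 ^ (j + 1)] := by
      rw [Nat.ModEq, h, Nat.mod_eq_of_lt hlt]
    have h2 := Nat.ModEq.add_right_cancel' 1 (show n + 1 ≡ (2 ^ j - 1) + 1 [MOD 2 ^ (j + 1)] by
      rw [Nat.sub_add_cancel hP]; exact h1)
    exact h2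
  · intro h
    have h1 : n + 1 ≡ 2 ^ j - 1 + 1 [MOD 2 ^ (j + 1)] := Nat.ModEq.add_right 1 h
    rw [Nat.sub_add_cancel hP] at h1
    rw [h1, Nat.mod_eq_of_lt hlt]

/-- Counting function of the schedule. -/
def cnt (j N : ℕ) : ℕ := ((range N).filter fun n => sched n = j).card

/-- `#{n < N : v₂(n+1) = j} = ⌊N/2^{j+1}⌋ + ε`, `ε ∈ {0,1}`. -/
theorem cnt_eq (j N : ℕ) : cnt j N =
    N / 2 ^ (j + 1) + if (2 ^ j - 1) % 2 ^ (j + 1) < N % 2 ^ (j + 1) then 1 else 0 := by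
  have h := Nat.count_modEq_card N (show 0 < 2 ^ (j + 1) by positivity) (2 ^ j - 1)
  rw [Nat.count_eq_card_filter_range] at h
  rw [← h, cnt]
  congr 1
  ext n
  simp only [mem_filter, Finset.mem_range, sched_eq_iff_modEq]

/-- `|#{n < N : v₂(n+1) = j} − N/2^{j+1}| ≤ 1`. -/
theorem abs_cnt_sub_le (j N : ℕ) : |(cnt j N : ℝ) - N / 2 ^ (j + 1)| ≤ 1 := by
  rw [cnt_eq]
  set P : ℕ := 2 ^ (j + 1) with hPdef
  have hP : 0 < P := by positivity
  have hPr : (0 : ℝ) < P := by exact_mod_cast hP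
  have hdm : (P : ℝ) * (N / P : ℕ) + (N % P : ℕ) = N := by exact_mod_cast Nat.div_add_mod N P
  have hmod : ((N % P : ℕ) : ℝ) < P := by exact_mod_cast Nat.mod_lt N hP
  have hmod0 : (0 : ℝ) ≤ (N % P : ℕ) := Nat.cast_nonneg _
  have hq : ((N / P : ℕ) : ℝ) = (N : ℝ) / P - (N % P : ℕ) / P := by
    field_simp
    linarith [hdm]
  have hPcast : ((2 : ℝ) ^ (j + 1)) = (P : ℝ) := by rw [hPdef]; push_cast; ring
  rw [hPcast, abs_le]
  split_ifs with hε
  · push_cast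
    rw [hq]
    constructor
    · have : ((N % P : ℕ) : ℝ) / P ≤ 1 := by rw [div_le_one hPr]; exact hmod.le
      linarith
    · have : (0 : ℝ) ≤ (N % P : ℕ) / P := div_nonneg hmod0 hPr.le
      linarith
  · push_cast
    rw [hq]
    constructor
    · have : ((N % P : ℕ) : ℝ) / P ≤ 1 := by rw [div_le_one hPr]; exact hmod.le
      linarith
    · have : (0 : ℝ) ≤ (N % P : ℕ) / P := div_nonneg hmod0 hPr.le
      linarith

/-- Every mode index recurs: `sched (2^j − 1) = j`. -/
theorem sched_two_pow_sub_one (j : ℕ) : sched (2 ^ j - 1) = j := by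
  rw [sched, Nat.sub_add_cancel Nat.one_le_two_pow, padicValNat.prime_pow]

/-! ## 2. Modes: an enumeration of `ℤ³ ∖ 0` up to sign, and a divergence-free polarisation -/

/-- `ℤ³` is countable: some map `ℕ → ℤ³` is onto. -/
theorem exists_enum : ∃ e : ℕ → Z3, Function.Surjective e := exists_surjective_nat Z3

/-- A surjection `ℕ → ℤ³`. -/
def enum : ℕ → Z3 := Classical.choose exists_enum

/-- `enum` is onto. -/
theorem enum_surjective : Function.Surjective enum := Classical.choose_spec exists_enum

/-- The fallback wave vector `e₀ = (1,0,0)`. -/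
def kvec0 : Z3 := Pi.single 0 1

/-- `e₀ ≠ 0`. -/
theorem kvec0_ne_zero : kvec0 ≠ 0 := by
  intro h
  have := congr_fun h 0
  simp [kvec0] at this

/-- The mode of index `j` (never zero). -/
def modeAt (j : ℕ) : Z3 := if enum j = 0 then kvec0 else enum j

/-- Every `modeAt j` is a nonzero wave vector. -/
theorem modeAt_ne_zero (j : ℕ) : modeAt j ≠ 0 := by
  unfold modeAt
  split_ifs with h
  · exact kvec0_ne_zero
  · exact h

/-- In `ℤ³`, `k = −k` forces `k = 0`. -/
theorem eq_zero_of_eq_neg {k : Z3} (h : k = -k) : k = 0 := by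
  funext i
  have := congr_fun h i
  simp only [Pi.neg_apply, Pi.zero_apply] at this ⊢
  omega

/-- No `modeAt j` equals its own negative. -/
theorem modeAt_ne_neg (j : ℕ) : modeAt j ≠ -modeAt j :=
  fun h => modeAt_ne_zero j (eq_zero_of_eq_neg h)

/-- Every nonzero wave vector is some `modeAt j`. -/
theorem exists_modeAt_eq {k : Z3} (hk : k ≠ 0) : ∃ j, modeAt j = k := by
  obtain ⟨j, hj⟩ := enum_surjective k
  refine ⟨j, ?_⟩
  unfold modeAt
  rw [if_neg (by rw [hj]; exact hk), hj]

/-- `a ~ b` iff `a = ±b`. -/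
def SameClass (a b : Z3) : Prop := a = b ∨ a = -b

/-- `SameClass` is reflexive. -/
theorem SameClass.refl (a : Z3) : SameClass a a := Or.inl rfl

/-- `SameClass` is symmetric. -/
theorem SameClass.symm {a b : Z3} (h : SameClass a b) : SameClass b a := by
  rcases h with h | h
  · exact Or.inl h.symm
  · exact Or.inr (by rw [h, neg_neg])

/-- `SameClass` is transitive. -/
theorem SameClass.trans {a b c : Z3} (h₁ : SameClass a b) (h₂ : SameClass b c) : SameClass a c := by
  rcases h₁ with h₁ | h₁ <;> rcases h₂ with h₂ | h₂
  · exact Or.inl (h₁.trans h₂)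
  · exact Or.inr (h₁.trans h₂)
  · exact Or.inr (by rw [h₁, h₂])
  · exact Or.inl (by rw [h₁, h₂, neg_neg])

/-- `SameClass a b` (`a = b ∨ a = -b`) is decidable. -/
instance (a b : Z3) : Decidable (SameClass a b) := inferInstanceAs (Decidable (_ ∨ _))

/-- Every index has some index in its `±`-class (itself), so `rep` is well defined. -/
theorem exists_sameClass (j : ℕ) : ∃ i, SameClass (modeAt i) (modeAt j) := ⟨j, SameClass.refl _⟩

/-- The least index of the `±`-class of mode `j`. -/
def rep (j : ℕ) : ℕ := Nat.find (exists_sameClass j)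

/-- `rep j` lies in the `±`-class of `j`. -/
theorem rep_spec (j : ℕ) : SameClass (modeAt (rep j)) (modeAt j) := Nat.find_spec (exists_sameClass j)

/-- `rep j ≤ j`. -/
theorem rep_le (j : ℕ) : rep j ≤ j := Nat.find_min' _ (SameClass.refl _)

/-- Indices in the same class have the same representative. -/
theorem rep_eq_of_sameClass {j₁ j₂ : ℕ} (h : SameClass (modeAt j₁) (modeAt j₂)) : rep j₁ = rep j₂ := by
  apply le_antisymm
  · exact Nat.find_min' _ ((rep_spec j₂).trans h.symm)
  · exact Nat.find_min' _ ((rep_spec j₁).trans h)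

/-- `rep` is idempotent. -/
theorem rep_rep (j : ℕ) : rep (rep j) = rep j := rep_eq_of_sameClass (rep_spec j)

/-- Every nonzero wave vector is `±` the mode of a self-representing («active») index. -/
theorem exists_active {k : Z3} (hk : k ≠ 0) : ∃ j, rep j = j ∧ SameClass (modeAt j) k := by
  obtain ⟨j₀, hj₀⟩ := exists_modeAt_eq hk
  exact ⟨rep j₀, rep_rep j₀, hj₀ ▸ rep_spec j₀⟩

/-- Two active indices in one class coincide. -/
theorem active_unique {j₁ j₂ : ℕ} (h₁ : rep j₁ = j₁) (h₂ : rep j₂ = j₂)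
    (h : SameClass (modeAt j₁) (modeAt j₂)) : j₁ = j₂ := by
  rw [← h₁, ← h₂]; exact rep_eq_of_sameClass h

/-- There are infinitely many active indices: they are unbounded. -/
theorem exists_active_ge (M : ℕ) : ∃ j, M ≤ j ∧ rep j = j := by
  by_contra hcon
  push Not at hcon
  -- every nonzero `k` is `± modeAt j` with `j < M`
  have hsub : {k : Z3 | k ≠ 0} ⊆
      ((Finset.range M).image modeAt ∪ (Finset.range M).image fun j => -modeAt j : Finset Z3) := by
    intro k hk
    obtain ⟨j, hj, hc⟩ := exists_active hk
    have hjM : j < M := by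
      by_contra hge; push Not at hge; exact hcon j hge hj
    simp only [Finset.coe_union, Finset.coe_image, Finset.coe_range, Set.mem_union, Set.mem_image,
      Set.mem_Iio]
    rcases hc with hc | hc
    · exact Or.inl ⟨j, hjM, hc⟩
    · exact Or.inr ⟨j, hjM, by rw [hc, neg_neg]⟩
  have hfin : {k : Z3 | k ≠ 0}.Finite := (Finset.finite_toSet _).subset hsub
  -- but `n ↦ (n+1) • e₀` is injective into it
  have hinj : Function.Injective fun n : ℕ => ((n : ℤ) + 1) • kvec0 := by
    intro a b hab
    have := congr_fun hab 0
    simp [kvec0] at this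
    exact_mod_cast this
  refine Set.infinite_of_injective_forall_mem hinj (fun n => ?_) hfin
  simp only [Set.mem_setOf_eq]
  intro h0
  have := congr_fun h0 0
  simp [kvec0] at this
  omega

/-- Divergence-free complex polarisation orthogonal to `k`: `(−k₁, k₀, 0)`, or `e₀` on the `k₂`-axis. -/
def pol (k : Z3) : C3 :=
  if k 0 = 0 ∧ k 1 = 0 then EuclideanSpace.single 0 1
  else (-(k 1 : ℂ)) • EuclideanSpace.single 0 1 + ((k 0 : ℂ)) • EuclideanSpace.single 1 1

/-- The polarisation is orthogonal to the wave vector: `Σ_i k_i · pol k i = 0` (divergence-free mode). -/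
theorem pol_divFree (k : Z3) : ∑ j, ((k j : ℂ)) * pol k j = 0 := by
  unfold pol
  split_ifs with h
  · simp [h.1]
  · simp [Fin.sum_univ_three]
    ring

/-- The polarisation of a nonzero wave vector is nonzero. -/
theorem pol_ne_zero (k : Z3) : pol k ≠ 0 := by
  unfold pol
  split_ifs with h
  · intro h0
    have := congr_arg (fun v : C3 => v 0) h0
    simp at this
  · intro h0
    by_cases h1 : k 1 = 0
    · have hk0 : k 0 ≠ 0 := fun h0' => h ⟨h0', h1⟩
      have := congr_arg (fun v : C3 => v 1) h0
      simp at this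
      exact hk0 (by exact_mod_cast this)
    · have := congr_arg (fun v : C3 => v 0) h0
      simp at this
      exact h1 (by exact_mod_cast this)

/-- `0 < ‖pol k‖` for `k ≠ 0`. -/
theorem norm_pol_pos (k : Z3) : 0 < ‖pol k‖ := norm_pos_iff.2 (pol_ne_zero k)

/-! ## 3. `klen`, the K41 profile, and the Cesàro limit lemma -/

/-- `1 ≤ |k|²` for a nonzero integer wave vector. -/
theorem one_le_freqNormSq {k : Z3} (hk : k ≠ 0) : 1 ≤ Torus.freqNormSq k := by
  obtain ⟨i, hi⟩ : ∃ i, k i ≠ 0 := by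
    by_contra h; push Not at h; exact hk (funext h)
  unfold Torus.freqNormSq
  have h1 : (1 : ℝ) ≤ (k i : ℝ) ^ 2 := by
    have : (1 : ℤ) ≤ k i ^ 2 := by nlinarith [sq_nonneg (k i), Int.one_le_abs hi, sq_abs (k i)]
    exact_mod_cast this
  exact h1.trans (Finset.single_le_sum (fun j _ => sq_nonneg ((k j : ℝ))) (Finset.mem_univ i))

/-- `1 ≤ |k|` for `k ≠ 0`. -/
theorem one_le_klen {k : Z3} (hk : k ≠ 0) : 1 ≤ klen k := by
  unfold klen
  rw [show (1 : ℝ) = Real.sqrt 1 by simp]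
  exact Real.sqrt_le_sqrt (one_le_freqNormSq hk)

/-- `0 < |k|` for `k ≠ 0`. -/
theorem klen_pos {k : Z3} (hk : k ≠ 0) : 0 < klen k := one_pos.trans_le (one_le_klen hk)

/-- `|a| = |b|` for `a = ±b`. -/
theorem klen_of_sameClass {a b : Z3} (h : SameClass a b) : klen a = klen b := by
  rcases h with h | h
  · rw [h]
  · rw [h]
    unfold klen Torus.freqNormSq
    simp

/-- The exact K41 profile `Φ(k) = |k|^{−5/3}` (`Φ(0) = 0`). -/
def PhiK (k : Z3) : ℝ := if k = 0 then 0 else klen k ^ (-(5 / 3 : ℝ))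

/-- Off the origin, `PhiK k = |k|^{-5/3}`. -/
theorem PhiK_of_ne {k : Z3} (hk : k ≠ 0) : PhiK k = klen k ^ (-(5 / 3 : ℝ)) := if_neg hk

/-- `PhiK` is an exact K41 spectrum in the typed sense (`IsK41`, constant `C = 1`). -/
theorem isK41_PhiK : IsK41 PhiK := by
  refine ⟨1, one_pos, tendsto_const_nhds.congr' ?_⟩
  have hcof : ∀ᶠ k : Z3 in cofinite, k ≠ 0 := (Set.finite_singleton (0 : Z3)).compl_mem_cofinite
  filter_upwards [hcof] with k hk
  rw [PhiK_of_ne hk, Real.rpow_neg (klen_pos hk).le, inv_mul_cancel₀ (Real.rpow_pos_of_pos (klen_pos hk) _).ne']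

/-- `PhiK` is bounded (`InfraredBounded`, bound `1`). -/
theorem infraredBounded_PhiK : InfraredBounded PhiK := by
  refine ⟨1, fun k => ?_⟩
  by_cases hk : k = 0
  · simp [PhiK, hk]
  · rw [PhiK_of_ne hk]
    exact Real.rpow_le_one_of_one_le_of_nonpos (one_le_klen hk) (by norm_num)


/-- **Cesàro limit lemma**: `|G(T) − A·T| ≤ B` for `T ≥ 1` gives `T⁻¹ G(T) → A`. -/
theorem tendsto_cesaro_of_linear {G : ℝ → ℝ} {A B : ℝ} (h : ∀ T : ℝ, 1 ≤ T → |G T - A * T| ≤ B) :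
    Tendsto (fun T : ℝ => T⁻¹ * G T) atTop (𝓝 A) := by
  have hB : Tendsto (fun T : ℝ => B * T⁻¹) atTop (𝓝 0) := by
    simpa using tendsto_inv_atTop_zero.const_mul B
  have hlo : Tendsto (fun T : ℝ => A - B * T⁻¹) atTop (𝓝 A) := by simpa using tendsto_const_nhds.sub hB
  have hhi : Tendsto (fun T : ℝ => A + B * T⁻¹) atTop (𝓝 A) := by simpa using tendsto_const_nhds.add hB
  refine tendsto_of_tendsto_of_tendsto_of_le_of_le' hlo hhi ?_ ?_
  · filter_upwards [eventually_ge_atTop (1 : ℝ)] with T hT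
    have hT0 : 0 < T := by linarith
    have key := (abs_le.1 (h T hT)).1
    have e : T⁻¹ * G T = A + T⁻¹ * (G T - A * T) := by field_simp; ring
    rw [e]
    have := mul_le_mul_of_nonneg_left key (inv_nonneg.2 hT0.le)
    linarith
  · filter_upwards [eventually_ge_atTop (1 : ℝ)] with T hT
    have hT0 : 0 < T := by linarith
    have key := (abs_le.1 (h T hT)).2
    have e : T⁻¹ * G T = A + T⁻¹ * (G T - A * T) := by field_simp; ring
    rw [e]
    have : T⁻¹ * (G T - A * T) ≤ B * T⁻¹ := by
      rw [mul_comm B]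
      exact mul_le_mul_of_nonneg_left key (inv_nonneg.2 hT0.le)
    linarith

end Summit.NavierStokesRegularity.NavierStokesRegularity.Theorems.LiuYong2026.K41Slot

end
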